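import Mathlib
import Literature.AlgebraicGeometry.Resolution.AdicCompletionInitialForms
import Literature.AlgebraicGeometry.Resolution.AdaptedCoordinateChartStep
import HarnessLib

/-!
# A totally prepared adapted coordinate in the completion, over an isolated point of `{ord ≥ μ}`

Topic: `Literature/AlgebraicGeometry/Resolution`. V. Cossart, U. Jannsen, S. Saito, *Desingularization:
invariants and strategy*, LNM 2270 (2020), Thm. 8.24 ("If `R` is complete, we can obtain the stronger
conclusion that `(g, z, u)` is well-prepared"), proof of Thm. 13.7 / Claim 13.8
[cite: CossartJannsenSaito2020, Thm. 8.24]; S. D. Cutkosky, Amer. J. Math. 131 (2009), Lemma 10.4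
[cite: Cutkosky2009, Lemma 10.4]; V. Cossart, O. Piltant, J. Algebra 321 (2009), proof of Prop. 4.4,
p. 11 ("`x` belongs to the strict transform of a formal curve") [cite: CossartPiltant2008, Prop. 4.4].

OURS (brick B4 of the `τ = 1` endgame, architecture (B) «complete once at the start»): let `R` be a
regular local G-ring of dimension `3`, `c = (y, u₁, u₂)` a regular system of parameters adapted to
`J ⊆ 𝔪^μ` (`L < δs`), the closed point isolated in `{ord J ≥ μ}`, and `v ∈ R̂` a third parameter of the
completion with `(y, u₁, v) R̂ = 𝔪̂` (in the endgame: the `𝔪`-adic limit of the shear-lifted `u₂`'s of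
`ShearLiftRecursion`). Then there is `ŷ ∈ R̂`, `ŷ ≡ y mod 𝔪̂² ∩ (u₁, v)`, such that `(ŷ, u₁, v)` is a
regular system of parameters of `R̂`, adapted to `J R̂` (`L < δs`), with non-empty polygon, prepared at
EVERY vertex (`PreparedUpTo … B` for all `B`), and `J R̂ ⊄ (ŷ, v)^μ`. Assembly of: `cl_μ`/adaptedness
and isolation ascend to `R̂` (`AdicCompletionInitialForms`), adaptedness depends on `y` only
(`AdaptedCoordinateChartStep`), no hypersurface germ `(ŷ + t)^μ ⊇ J R̂` and `J R̂ ⊄ (ŷ, v)^μ` by isolation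
at the primes `(ŷ + t)`, `(ŷ, v)` of `R̂`, and total preparation in the complete ring
(`TotalPreparation.exists_preparedUpTo_forall_of_forall_not_le`). F-71 / T1 / N2 NOT proved; no summit
statement is proved.
-/

noncomputable section

open IsLocalRing MvPolynomial

namespace Literature.AlgebraicGeometry.Resolution

universe u

section Isolated

variable {S : Type u} [CommRing S]

/-- Isolation at a prime `𝔓` forbids `J ⊆ 𝔓^μ`. [folklore] -/
private theorem not_le_prime_pow_of_isolated {J : Ideal S} {μ : ℕ} (𝔓 : Ideal S) [𝔓.IsPrime]
    (h : ¬ J.map (algebraMap S (Localization.AtPrime 𝔓)) ≤ maximalIdeal (Localization.AtPrime 𝔓) ^ μ) :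
    ¬ J ≤ 𝔓 ^ μ := by
  intro hle
  apply h
  calc J.map (algebraMap S (Localization.AtPrime 𝔓))
      ≤ (𝔓 ^ μ).map (algebraMap S (Localization.AtPrime 𝔓)) := Ideal.map_mono hle
    _ = maximalIdeal (Localization.AtPrime 𝔓) ^ μ := by
        rw [Ideal.map_pow, Localization.AtPrime.map_eq_maximalIdeal]

/-- `(y + t, u₁, u₂) = 𝔪` for `t ∈ (u₁, u₂)`. [folklore] -/
private theorem span_triple_add_eq_of_mem_span_pair {y u w t : S}
    [IsLocalRing S] (hgen : Ideal.span {y, u, w} = maximalIdeal S)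
    (ht : t ∈ Ideal.span ({u, w} : Set S)) : Ideal.span {y + t, u, w} = maximalIdeal S := by
  obtain ⟨r₁, r₂, hr⟩ := Ideal.mem_span_pair.mp ht
  rw [← hgen, ← hr]
  have hsub : ∀ y₀ : S, r₁ * u + r₂ * w ∈ Ideal.span ({y₀, u, w} : Set S) := fun y₀ =>
    Ideal.add_mem _ (Ideal.mul_mem_left _ _ (Ideal.subset_span (by simp)))
      (Ideal.mul_mem_left _ _ (Ideal.subset_span (by simp)))
  apply le_antisymm
  · rw [Ideal.span_le]
    rintro z (rfl | rfl | rfl)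
    · exact Ideal.add_mem _ (Ideal.subset_span (by simp)) (hsub y)
    · exact Ideal.subset_span (by simp)
    · exact Ideal.subset_span (by simp)
  · rw [Ideal.span_le]
    rintro z (rfl | rfl | rfl)
    · have h1 : z + (r₁ * u + r₂ * w) ∈ Ideal.span ({z + (r₁ * u + r₂ * w), u, w} : Set S) :=
        Ideal.subset_span (by simp)
      have h := Ideal.sub_mem _ h1 (hsub (z + (r₁ * u + r₂ * w)))
      rwa [add_sub_cancel_right] at h
    · exact Ideal.subset_span (by simp)
    · exact Ideal.subset_span (by simp)

variable [IsRegularLocalRing S] (hfr : (maximalIdeal S).spanFinrank = 3) (x : Fin 3 → S)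
  (hx : Ideal.span {x 0, x 1, x 2} = maximalIdeal S)

include hfr hx in
/-- `(x₀)` is a prime different from `𝔪` for a regular system of parameters `x` of a three-dimensional
regular local ring. [cite: Matsumura1987, Thm. 17.8] -/
private theorem span_singleton_isPrime_and_ne :
    (Ideal.span ({x 0} : Set S)).IsPrime ∧ Ideal.span ({x 0} : Set S) ≠ maximalIdeal S := by
  have hxr := span_range_eq_of_span_triple x hx
  refine ⟨?_, fun h => ?_⟩
  · have := isPrime_span_image hfr x hxr {0}
    rwa [Finset.coe_singleton, Set.image_singleton] at this
  · have hle : (Ideal.span ({x 0} : Set S)).spanFinrank ≤ ({x 0} : Set S).ncard :=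
      Submodule.spanFinrank_span_le_ncard_of_finite (Set.finite_singleton (x 0))
    rw [Set.ncard_singleton] at hle
    have h3 : (Ideal.span ({x 0} : Set S)).spanFinrank = 3 := by rw [h]; exact hfr
    omega

include hfr hx in
/-- `(x₀, x₂)` is a prime different from `𝔪` for a regular system of parameters `x` of a
three-dimensional regular local ring. [cite: Matsumura1987, Thm. 17.8] -/
private theorem span_pair_isPrime_and_ne :
    (Ideal.span ({x 0, x 2} : Set S)).IsPrime ∧ Ideal.span ({x 0, x 2} : Set S) ≠ maximalIdeal S := by
  have hxr := span_range_eq_of_span_triple x hx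
  refine ⟨?_, fun h => ?_⟩
  · have := isPrime_span_image hfr x hxr {0, 2}
    rwa [Finset.coe_insert, Finset.coe_singleton, Set.image_insert_eq, Set.image_singleton] at this
  · have hfin : ({x 0, x 2} : Set S).Finite := Set.toFinite _
    have hle : (Ideal.span ({x 0, x 2} : Set S)).spanFinrank ≤ ({x 0, x 2} : Set S).ncard :=
      Submodule.spanFinrank_span_le_ncard_of_finite hfin
    have hcard : ({x 0, x 2} : Set S).ncard ≤ 2 := by
      refine (Set.ncard_insert_le _ _).trans ?_
      rw [Set.ncard_singleton]
    have h3 : (Ideal.span ({x 0, x 2} : Set S)).spanFinrank = 3 := by rw [h]; exact hfr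
    omega

end Isolated

section Main

variable {R : Type u} [CommRing R] [IsRegularLocalRing R]

/-- **B4 (OURS). A totally prepared adapted coordinate in the completion over an isolated point of
`{ord ≥ μ}`.** Let `R` be a regular local G-ring of dimension `3`, `c = (y, u₁, u₂)` a regular system
of parameters with `J ⊆ 𝔪^μ` adapted (`L < δs`), the closed point isolated in `{ord J ≥ μ}`, and
`v ∈ R̂` with `(y, u₁, v) R̂ = 𝔪̂`. Then there is `ŷ ∈ R̂` with `ŷ − y ∈ 𝔪̂² ∩ (u₁, v) R̂` such that
`(ŷ, u₁, v)` is a regular system of parameters of `R̂` adapted to `J R̂` (`L < δs`) with non-empty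
polygon, prepared at every vertex (`PreparedUpTo` for every bound), and `J R̂ ⊄ (ŷ, v)^μ`. (The
regularity of `R̂` is taken as an instance argument; supply `isRegularLocalRing_adicCompletion R`.)
[cite: CossartJannsenSaito2020, Thm. 8.24, Thm. 13.7 (proof)] [cite: Cutkosky2009, Lemma 10.4]
[cite: CossartPiltant2008, Prop. 4.4 (proof, p. 11)] [cite: Matsumura1987, §32 p. 256] -/
theorem exists_totallyPrepared_adicCompletion (hG : IsGRing R) (c : Fin 3 → R)
    (hgen : Ideal.span {c 0, c 1, c 2} = maximalIdeal R) (hdim : ringKrullDim R = 3)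
    {J : Ideal R} {μ : ℕ} (hJμ : J ≤ maximalIdeal R ^ μ) (hδ : μ.factorial < deltaS c J μ)
    (hisol : ∀ (𝔮 : Ideal R) [𝔮.IsPrime], 𝔮 ≠ maximalIdeal R →
      ¬ J.map (algebraMap R (Localization.AtPrime 𝔮)) ≤ maximalIdeal (Localization.AtPrime 𝔮) ^ μ)
    [IsRegularLocalRing (AdicCompletion (maximalIdeal R) R)] (v : (AdicCompletion (maximalIdeal R) R))
    (hv : Ideal.span {algebraMap R (AdicCompletion (maximalIdeal R) R) (c 0), algebraMap R (AdicCompletion (maximalIdeal R) R) (c 1), v} = maximalIdeal (AdicCompletion (maximalIdeal R) R)) :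
    ∃ y : (AdicCompletion (maximalIdeal R) R), y - algebraMap R (AdicCompletion (maximalIdeal R) R) (c 0) ∈ maximalIdeal (AdicCompletion (maximalIdeal R) R) ^ 2 ∧
      y - algebraMap R (AdicCompletion (maximalIdeal R) R) (c 0) ∈ Ideal.span ({algebraMap R (AdicCompletion (maximalIdeal R) R) (c 1), v} : Set (AdicCompletion (maximalIdeal R) R)) ∧
      Ideal.span {y, algebraMap R (AdicCompletion (maximalIdeal R) R) (c 1), v} = maximalIdeal (AdicCompletion (maximalIdeal R) R) ∧
      (pts ![y, algebraMap R (AdicCompletion (maximalIdeal R) R) (c 1), v] (J.map (algebraMap R (AdicCompletion (maximalIdeal R) R))) μ).Nonempty ∧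
      μ.factorial < deltaS ![y, algebraMap R (AdicCompletion (maximalIdeal R) R) (c 1), v] (J.map (algebraMap R (AdicCompletion (maximalIdeal R) R))) μ ∧
      (∀ B, PreparedUpTo ![y, algebraMap R (AdicCompletion (maximalIdeal R) R) (c 1), v] (J.map (algebraMap R (AdicCompletion (maximalIdeal R) R))) μ B) ∧
      ¬ J.map (algebraMap R (AdicCompletion (maximalIdeal R) R)) ≤ Ideal.span {y, v} ^ μ := by
  classical
  have hdimh : ringKrullDim (AdicCompletion (maximalIdeal R) R) = 3 := by rw [ringKrullDim_adicCompletion, hdim]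
  have hfr : (maximalIdeal (AdicCompletion (maximalIdeal R) R)).spanFinrank = 3 := by
    have h := IsRegularLocalRing.spanFinrank_maximalIdeal (R := (AdicCompletion (maximalIdeal R) R))
    rw [hdimh] at h
    exact_mod_cast h
  -- the ideal `J R̂ ⊆ 𝔪̂^μ`
  have hJμ' : J.map (algebraMap R (AdicCompletion (maximalIdeal R) R)) ≤ maximalIdeal (AdicCompletion (maximalIdeal R) R) ^ μ := by
    rw [AdicCompletion.maximalIdeal_eq_map, ← Ideal.map_pow]; exact Ideal.map_mono hJμ
  -- the system `ι ∘ c` and the system `ct = (y, u₁, v)`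
  have hgenι : Ideal.span {algebraMap R (AdicCompletion (maximalIdeal R) R) (c 0), algebraMap R (AdicCompletion (maximalIdeal R) R) (c 1), algebraMap R (AdicCompletion (maximalIdeal R) R) (c 2)} =
      maximalIdeal (AdicCompletion (maximalIdeal R) R) := by
    have h := congrArg (Ideal.map (algebraMap R (AdicCompletion (maximalIdeal R) R))) hgen
    rw [Ideal.map_span, Set.image_insert_eq, Set.image_insert_eq, Set.image_singleton,
      ← AdicCompletion.maximalIdeal_eq_map] at h
    exact h
  set ct : Fin 3 → (AdicCompletion (maximalIdeal R) R) := ![algebraMap R (AdicCompletion (maximalIdeal R) R) (c 0), algebraMap R (AdicCompletion (maximalIdeal R) R) (c 1), v] with hct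
  have hgen_t : Ideal.span {ct 0, ct 1, ct 2} = maximalIdeal (AdicCompletion (maximalIdeal R) R) := hv
  -- adaptedness ascends to `R̂` and depends on `y` only
  have hadι := forall_initialForms_map_adicCompletion c hgen hdim hJμ
    (forall_initialForms_of_lt_deltaS c hgen hdim hJμ hδ)
  have had_t : ∀ G ∈ initialForms ct (J.map (algebraMap R (AdicCompletion (maximalIdeal R) R))) μ,
      ∃ a : ResidueField (AdicCompletion (maximalIdeal R) R), G = C a * X 0 ^ μ :=
    forall_initialForms_of_eq_zero (fun i => algebraMap R (AdicCompletion (maximalIdeal R) R) (c i)) hdimh hJμ' ct hgenι hgen_t rfl hadι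
  -- isolation ascends to `R̂`: no hypersurface germ `(y + t)^μ ⊇ J R̂`
  have hisol' := isolated_map_adicCompletion (R := R) hG hisol
  have hhyp : ∀ t ∈ Ideal.span ({ct 1, ct 2} : Set (AdicCompletion (maximalIdeal R) R)),
      ¬ J.map (algebraMap R (AdicCompletion (maximalIdeal R) R)) ≤ Ideal.span {(ct 0 + t) ^ μ} := by
    intro t ht hle
    have hgen_s : Ideal.span {ct 0 + t, ct 1, ct 2} = maximalIdeal (AdicCompletion (maximalIdeal R) R) :=
      span_triple_add_eq_of_mem_span_pair hgen_t ht
    obtain ⟨hP, hPne⟩ := span_singleton_isPrime_and_ne hfr (![ct 0 + t, ct 1, ct 2]) hgen_s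
    haveI := hP
    refine not_le_prime_pow_of_isolated (Ideal.span ({(![ct 0 + t, ct 1, ct 2] : Fin 3 → (AdicCompletion (maximalIdeal R) R)) 0} : Set (AdicCompletion (maximalIdeal R) R)))
      (hisol' _ hPne) ?_
    rw [Ideal.span_singleton_pow]
    exact hle
  -- the polygon of `ct` is non-empty and `ct` is adapted
  have hne_t : (pts ct (J.map (algebraMap R (AdicCompletion (maximalIdeal R) R))) μ).Nonempty := by
    refine (pts_nonempty_iff_not_le_span_pow ct hgen_t hdimh _ μ).mpr ?_
    have h := hhyp 0 (Ideal.zero_mem _)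
    rwa [add_zero] at h
  have hδ_t : μ.factorial < deltaS ct (J.map (algebraMap R (AdicCompletion (maximalIdeal R) R))) μ :=
    lt_deltaS_of_forall_initialForms ct hgen_t hdimh hJμ' hne_t had_t
  -- total preparation in the complete ring `R̂`
  obtain ⟨cs, hcs1, hcs2, hsq, hsp, hgen_s, -, hne_s, hδ_s, hprep⟩ :=
    exists_preparedUpTo_forall_of_forall_not_le hdimh ct hgen_t hhyp hδ_t
  have hcs : cs = ![cs 0, algebraMap R (AdicCompletion (maximalIdeal R) R) (c 1), v] := by
    funext i
    fin_cases i
    · rfl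
    · exact hcs1
    · exact hcs2
  refine ⟨cs 0, hsq, hsp, ?_, ?_, ?_, ?_, ?_⟩
  · rw [hcs] at hgen_s; exact hgen_s
  · rw [hcs] at hne_s; exact hne_s
  · rw [hcs] at hδ_s; exact hδ_t.trans_le hδ_s
  · rw [hcs] at hprep; exact hprep
  · -- `J R̂ ⊄ (ŷ, v)^μ` by isolation at the prime `(ŷ, v)`
    obtain ⟨hP, hPne⟩ := span_pair_isPrime_and_ne hfr cs hgen_s
    haveI := hP
    have h := not_le_prime_pow_of_isolated (Ideal.span ({cs 0, cs 2} : Set (AdicCompletion (maximalIdeal R) R))) (hisol' _ hPne)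
    rwa [hcs2] at h

end Main

end Literature.AlgebraicGeometry.Resolution

end
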